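import Summits.QuantumFields.YangMills.Theorems.BalabanUVNodesK0ConstantDirectionTower
import Summits.QuantumFields.YangMills.Theorems.FluctuationComparisonRegPrIntLS2BetaSmallBondGaugeToronAbelianStratum
import Summits.QuantumFields.YangMills.Theorems.FluctuationComparisonRegPrIntLS2BetaSmallBondGaugeToronObstruction
import Summits.QuantumFields.YangMills.Theorems.FluctuationComparisonRegPrIntLS2BetaWhitneyHatLift
import Summits.QuantumFields.YangMills.Theorems.FluctuationComparisonRegPrIntLS2BetaLiftLadderCombRowTower
import HarnessLib

/-!
# S2β ∕ GAP♯∘ sup chain — THE ARC-PROFILE LETTER IS FALSE ON THE ABELIAN STRATUM: the `hARC` socket of the supplier knits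
# ✓`…SupTowerLetterOfSuppliers(Sigma).supTowerLetter3∕4_of_arc_discSplit`, instantiated at the `A′`-guard of knits v4–v7, is refuted by a flat toron on the `6³` datum torus

Cell `ym3-torus` (YM ladder rung R3 = continuum `SU(2)` Yang–Mills on the three-torus `T³` — a RUNG: NOT d = 4, NOT infinite volume, NOT a mass gap, NOT Clay).
LEAD-20520 seat `ym-ust-20520-w3` (gen 29), DECIDING seat of the R3 lineage; explicit-unit helper mode on the crux `stmt-QuantumFields-20520`
(`FluctuationComparisonRegPrIntL`; registry `Lines/semiclassical_s2beta.lean` 3732b7df FROZEN ∕ untouched; `--supports`, count-neutral).  DEFINITION-FREE.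

WHAT THIS FILE DECIDES (a kernel `¬`, not a heuristic).  The supplier knits ✓p835801 (‴) ∕ ✓p836564 (⁗) reduce the (ST) input of the GAP♯∘ sup chain to two θ-generic,
GUARD-INDEXED letters `hARC` (arc profile of the two stage towers: every gauged tower bond at internal heights `1 ≤ i < K − J` has arc `≤ 1∕4`) and `hDBX`.  Knits v4–v7
(✓p834885 ∕ ✓p836047 ∕ ✓`…GapOrbitOfArcDiscSplit`) consume `hARC` at TWO guards: the irreducible stratum `G_IRR` and the abelian stratum
`G_A′ V :≡ ∃ g, (∀ e, Commute ((g • V) e) σ₃) ∧ «every (g • V)-covariantly-constant matrix field is constant and σ₃-commuting»`.  THIS FILE PROVES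
★★★ `arcLetter4_abelianStratum_false : ¬ hARC⁗(G_A′)` and ★★★ `not_forall_guard_arcLetter4 : ¬ (∀ G, hARC⁗ G)` (the knit's socket read as ONE guard-uniform term is
uninhabited); the ‴ letter (no Σ-guard; ✓p835801's socket) at `G_A′` is refuted a fortiori (a ‴ letter yields the ⁗ one by ignoring the guard — not restated here).  CONSEQUENCE FOR THE LANE (UV3-NODE §90 ∕ §109; LEAD №21 «D-GUARD QUANTIFIED»): on the abelian stratum the
(E5)∕⁗ sup-chain road cannot be closed by ANY supplier of `hARC` — px12's ✓`…ArcLetterOfGuard.arcLetter_of_guard` is correct exactly on guards carrying the small-bond conjunct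
`∀ e, arc(V e) ≤ 1∕128`, and ✓`…SmallBondGaugeToronAbelianStratum.not_hsupp_abelianStratum` already showed no re-gauging supplier reaches that conjunct on `A′`; here the
LETTER ITSELF is refuted, so the abelian stratum needs a RESHAPED START (a volume∕co-height floor `F.m + J ≥ m*(L)` in the consumer, or a «late-start» letter for the top
`⌈log_L(π∕(M(L)·N_J))⌉` levels of near-flat data with O(1) commuting holonomy) — a planner∕architect decision, not a supplier.

THE WITNESS.  Block size `L = 3`, background constant `C_B = 0`; for every `α₀ > 0`: the member `F = (L, m) = (3, 1)`, `J = 0`, `K = 2` (datum lattice `F.P 0`, `6` sites per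
direction; fine lattice `F.P 2`, `54`); `α = min α₀ (1∕2000)`, `θ ≡ 2α∕225` (so `((5L)²∕4)·θ_i = α∕2`: sup window and Σ-window hold, `α ≤ 1∕24`, `α < δ_SU = 1∕3`,
`157α < 1∕9`); `U₀ = W = U₁ :=` the constant-direction field `D = expPoint ((1∕9)·e₀)` on the direction-`0` bonds, `1` elsewhere (§1: its `j`-fold (0.4) average is the toron
`D^{3ʲ} = expPoint ((3ʲ∕9)·e₀)` — ✓`K0ConstantDirectionTower.avgFun_constDir` iterated; every plaquette of every level is `1`, so `U₀ ∈ histGood` for every positive schedule and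
the (BKG) clause holds with `C_B = 0`; the datum `descendTo U₀` is the coarse toron `expPoint (1·e₀)` on the `6³` torus, which satisfies `G_A′` by
✓`…SmallBondGaugeToronAbelianStratum.toron_mem_abelianStratum` since `sin 6 ≠ 0`); `ζ = 0`; the `AxStage` witness `(wt, lift, U₁, g, g₀) = (hat weights, hat lift, U₀, 1, 1)`:
the geodesic hat lift of the toron level `j + 1` IS the toron level `j` (§1 `hatLift_constDir`: hat weights live on same-direction coarse bonds and sum to `1`
(✓`…WhitneyHatWeights.sum_hatW_eq_one` ∕ `hatW_support`); geodesic cube roots `expPoint (3⁻¹ • logVec (expPoint ((3^{j+1}∕9)·e₀))) = expPoint ((3ʲ∕9)·e₀)`, no wrap-around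
since `3^{j+1}∕9 ≤ 1 < π`), whence all seventeen stage-axial clauses hold with the trivial gauges.  The letter's conclusion at internal height `i = 1`, direction-`0` bond:
`arc(expPoint ((1∕3)·e₀)) = 1∕3 ≤ 1∕4` — false.

HONEST FRAMING.  [folklore] lattice bookkeeping (constant abelian fields, their block averages, hat lifts and arcs); NOTHING of Bałaban's renormalisation-group analysis is
asserted, proved or refuted — [Balaban1985RegularSpaces] Lemma 1 ∕ (1.29) is a SMALL-FIELD statement in plaquettes AND axial bonds and is not contradicted: the toron has
large bonds in every gauge on a small torus (print works with block counts `L^{k₀} ≤` volume).  NOT refuted: GAP♯∘, S2β, the knits (their OTHER hypotheses and their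
implications stand), px12's guarded arc letters, `hDBX`.  What IS refuted: the θ-generic ∀-data arc-profile letter at the `A′` guard (and hence as a guard-uniform term).
The five registered stubs (3732b7df UNTOUCHED, 0∕5), 20520, 19936, 19200, `YM3TorusSU2` NOT proved; rung R3 = SU(2) YM₃ on T³ — NOT d = 4, NOT infinite volume, NOT a
mass gap, NOT Clay.  Sorry-free; axioms {propext, Classical.choice, Quot.sound}; one decl-local `maxHeartbeats 400000` (letter-sized binder, as the knits).
-/

set_option autoImplicit false

noncomputable section

namespace Summit.QuantumFields.YangMills.Theorems.FluctuationComparisonRegPrIntLS2BetaArcLetterAbelianStratumFalse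

open scoped Real
open Finset
open Literature.MathematicalPhysics.QuantumLattice (su2Quat)
open Literature.MathematicalPhysics.QuantumFieldTheory.Balaban1983to89
open Literature.MathematicalPhysics.QuantumFieldTheory.Balaban1983to89.T4Continuum
open Literature.MathematicalPhysics.QuantumFieldTheory.Balaban1983to89.T3ContinuumYM3Torus
open Literature.MathematicalPhysics.QuantumFieldTheory.Balaban1983to89.T3UnitScaleTilt
open Literature.MathematicalPhysics.QuantumFieldTheory.Balaban1983to89.T3TiltDescent
open Literature.MathematicalPhysics.QuantumFieldTheory.Balaban1983to89.T3LevelShift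
open Literature.MathematicalPhysics.QuantumFieldTheory.Balaban1983to89.BlockAveraging
open Literature.MathematicalPhysics.QuantumFieldTheory.Balaban1983to89.T3UnitLawDensityEML (ℰp)
open Literature.MathematicalPhysics.QuantumFieldTheory.Balaban1983to89.ExpMeanLog (deltaSU)
open Literature.MathematicalPhysics.QuantumFieldTheory.Balaban1983to89.B10Eq27TorusAxialLog (unitsField toUField rel axialT)
open Literature.MathematicalPhysics.QuantumFieldTheory.Balaban1983to89.B9AdOrthogonal (σ₃)
open Literature.MathematicalPhysics.QuantumFieldTheory.Balaban1983to89.T4CubeChartGnomonic (SU2)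
open Literature.MathematicalPhysics.QuantumFieldTheory.Balaban1983to89.T4HaarSU2ExpChart (expPoint expPoint_zero)
open Literature.MathematicalPhysics.QuantumFieldTheory.Balaban1983to89.T4ExpWindowSmallField (logVec)
open Literature.MathematicalPhysics.QuantumFieldTheory.Balaban1983to89.T3DescentFibreTower (expMeanLogSU_E_one)
open Summit.QuantumFields.YangMills.Theorems.K0ConstantDirectionTower (avgFun_constDir plaqHol_constDir axialAvg_constDir pathProd_constDir)
open Summit.QuantumFields.YangMills.Theorems.FluctuationComparisonRegPrIntLS2BetaSmallBondGaugeToronObstruction (expPoint_smul_pow)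
open Summit.QuantumFields.YangMills.Theorems.FluctuationComparisonRegPrIntLS2BetaWhitneyHatWeights (sum_hatW_eq_one hatW_support)
open Summit.QuantumFields.YangMills.Theorems.FluctuationComparisonRegPrIntLS2BetaGeodesicJensenLift (norm_logVec_su2Quat_expPoint)
open Summit.QuantumFields.YangMills.Theorems.FluctuationComparisonRegPrIntLS2BetaLiftLadderCombRowTower (descendTo_apply_eq_iter_of_eq)

/-! ## §1 The constant-direction tower on a T³ member: averages, hat lifts, arcs -/

/-- The `j`-fold (0.4) average of the constant-direction field `D` (direction `μ₀`, `1` elsewhere) on `F.P K` is the constant-direction field `D ^ (L ^ j)`. [cite: Balaban1987RG1, (0.4), (0.11) p.253] -/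
theorem iter_constDir (F : T3Family) (K : ℕ) (D : SU2) (μ₀ : Fin (F.P K).d) {U : GaugeField (F.P K) 0 SU2}
    (hU : ∀ b, U b = if b.dir = μ₀ then D else 1) :
    ∀ (j : ℕ) (b : PBond (F.P K) j),
      Averaging.iter (fun k => blockAvg (P := F.P K) (j := k) ℰp) j U b = if b.dir = μ₀ then D ^ (F.L ^ j) else 1
  | 0, b => by
      show U b = _
      rw [hU, pow_zero, pow_one]
  | j + 1, b => by
      show (blockAvg (P := F.P K) (j := j) ℰp).avg (Averaging.iter (fun k => blockAvg (P := F.P K) (j := k) ℰp) j U) b = _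
      rw [blockAvg_avg, avgFun_constDir ℰp expMeanLogSU_E_one (D ^ (F.L ^ j)) μ₀ (iter_constDir F K D μ₀ hU j) b,
        show (F.P K).L = F.L from rfl, ← pow_mul, ← pow_succ]

/-- The geodesic hat lift of a constant-direction coarse field is the constant-direction field of the `L`-th geodesic root (on the parallel fine bonds) and `1`
elsewhere: the hat weights of a fine bond live on coarse bonds of the SAME direction and sum to `1`. [cite: Balaban1985RegularSpaces, (1.29) p.81] -/
theorem hatLift_constDir {P : Params} {t : ℕ} (ht : t + 1 ≤ P.m + P.K) (w : PBond P t → PBond P (t + 1) → ℝ)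
    (hw : ∀ b e, w b e = if e.dir = b.dir ∧ (b.src b.dir - emb e.src b.dir).val < P.L then
      ∏ ν ∈ Finset.univ.erase b.dir, max 0 (1 - ((rel (emb e.src) b.src ν).natAbs : ℝ) / P.L) else 0)
    (E : SU2) (μ₀ : Fin P.d) {X : GaugeField P (t + 1) SU2} (hX : ∀ e, X e = if e.dir = μ₀ then E else 1) (b : PBond P t) :
    expPoint (∑ e, w b e • ((P.L : ℝ)⁻¹ • logVec (su2Quat (X e)))) =
      if b.dir = μ₀ then expPoint ((P.L : ℝ)⁻¹ • logVec (su2Quat E)) else 1 := by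
  by_cases hb : b.dir = μ₀
  · rw [if_pos hb]
    have hterm : ∀ e, w b e • ((P.L : ℝ)⁻¹ • logVec (su2Quat (X e))) = w b e • ((P.L : ℝ)⁻¹ • logVec (su2Quat E)) := by
      intro e
      by_cases hwe : w b e = 0
      · rw [hwe, zero_smul, zero_smul]
      · have hdir := (hatW_support ht w hw hwe).1
        rw [hX e, if_pos (hdir.trans hb)]
    rw [Finset.sum_congr rfl fun e _ => hterm e, ← Finset.sum_smul, sum_hatW_eq_one ht w hw b, one_smul]
  · rw [if_neg hb]
    have hterm : ∀ e, w b e • ((P.L : ℝ)⁻¹ • logVec (su2Quat (X e))) = 0 := by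
      intro e
      by_cases hwe : w b e = 0
      · rw [hwe, zero_smul]
      · have hdir := (hatW_support ht w hw hwe).1
        have hne : e.dir ≠ μ₀ := fun h => hb (hdir.symm.trans h)
        rw [hX e, if_neg hne, FluctuationComparisonRegPrIntLS2BetaWhitneyHatLift.logVec_su2Quat_one, smul_zero, smul_zero]
    rw [Finset.sum_congr rfl fun e _ => hterm e, Finset.sum_const_zero, expPoint_zero]

/-- The `L`-th geodesic root of `expPoint (β·e₀)` in the chart: `expPoint (L⁻¹ • logVec (expPoint (β • e₀))) = expPoint ((L⁻¹·β) • e₀)` for `|β| < π`. [folklore] -/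
theorem expPoint_root_e0 (Lr β : ℝ) (hβ : |β| < Real.pi) :
    expPoint (Lr⁻¹ • logVec (su2Quat (expPoint (β • EuclideanSpace.single (0 : Fin 3) (1 : ℝ))))) =
      expPoint ((Lr⁻¹ * β) • EuclideanSpace.single (0 : Fin 3) (1 : ℝ)) := by
  have hn : ‖β • EuclideanSpace.single (0 : Fin 3) (1 : ℝ)‖ < Real.pi := by
    rw [norm_smul, Real.norm_eq_abs, PiLp.norm_single, norm_one, mul_one]; exact hβ
  rw [FluctuationComparisonRegPrIntLS2BetaWhitneyHatLiftRelative.logVec_su2Quat_expPoint hn, smul_smul]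

/-- The arc of `expPoint (β·e₀)` is `|β|` for `|β| ≤ π`. [folklore] -/
theorem arc_expPoint_e0 (β : ℝ) (hβ : |β| ≤ Real.pi) :
    ‖logVec (su2Quat (expPoint (β • EuclideanSpace.single (0 : Fin 3) (1 : ℝ))))‖ = |β| := by
  have hn : ‖β • EuclideanSpace.single (0 : Fin 3) (1 : ℝ)‖ = |β| := by
    rw [norm_smul, Real.norm_eq_abs, PiLp.norm_single, norm_one, mul_one]
  rw [norm_logVec_su2Quat_expPoint (by rw [hn]; exact hβ), hn]

/-- `sin 6 ≠ 0` (`π < 6 < 2π`). [folklore] -/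
theorem sin_six_ne_zero : Real.sin 6 ≠ 0 := by
  have h1 : Real.sin (6 - Real.pi) > 0 :=
    Real.sin_pos_of_pos_of_lt_pi (by linarith [Real.pi_lt_four]) (by linarith [Real.pi_gt_three])
  rw [Real.sin_sub_pi] at h1; linarith

/-! ## §2 The refutation: `hARC⁗` at the abelian-stratum guard `G_A′` is FALSE (witness: the flat toron at `(L, F.m, J, K) = (3, 1, 0, 2)`, angle `1∕9` per fine bond) -/

set_option maxHeartbeats 400000 in
/-- ★★★ **THE ARC-PROFILE LETTER ⁗ IS FALSE ON THE ABELIAN STRATUM.**  The `hARC` hypothesis of ✓`…SupTowerLetterOfSuppliersSigma.supTowerLetter4_of_arc_discSplit`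
instantiated at the `A′`-guard `G_A′` of knits v4–v7 (∃ abelian gauge + covariantly-constant-commutant condition) is refuted by the flat `e₀`-toron: block size `L = 3`,
`C_B = 0`, the member `(L, m) = (3, 1)`, `J = 0`, `K = 2` (datum torus `6³`), `U₀ = W = U₁ :=` the constant-direction field `expPoint ((1∕9)·e₀)` in direction `0`
(every averaged level is the toron `expPoint ((3ʲ∕9)·e₀)`, every plaquette is `1`, the datum `expPoint (1·e₀)` lies on `A′` since `sin 6 ≠ 0`), `ζ = 0`, the `AxStage`
witness `(wt, lift, U₁, g, g₀) = (hat weights, hat lift, U₀, 1, 1)` (the hat lift of each toron level IS the level below: geodesic `L`-th roots, no wrap-around), every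
window∕Σ-window∕(BKG)∕fibre clause satisfied — and at internal height `i = 1` the gauged tower bond is `expPoint ((1∕3)·e₀)` of arc `1∕3 > 1∕4`.
[cite: Balaban1985RegularSpaces, (1.29) p.81; Balaban1987RG1, (0.4), (0.11) p.253] -/
theorem arcLetter4_abelianStratum_false :
    ¬ (∀ (L : ℕ), 1 < L → ∀ (C_B : ℝ), 0 ≤ C_B → ∃ α₀ : ℝ, 0 < α₀ ∧ ∀ (F : T3Family), F.L = L →
      ∀ (J K : ℕ) (hJK : J ≤ K) (θ : ℕ → ℝ), (∀ i, 0 ≤ θ i) → ∀ (α : ℝ), (∀ i, J < i → i ≤ K → (((5 * F.L : ℕ) : ℝ) ^ 2 / 4) * θ i ≤ α) →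
        (∑ i ∈ Finset.range (K - J), (((5 * F.L : ℕ) : ℝ) ^ 2 / 4) * θ (K - i)) ≤ α →
        α ≤ 1 / 24 → α < deltaSU (Fin 2) → 157 * α < ((F.L : ℝ) ^ 2)⁻¹ → α ≤ α₀ →
        ∀ U₀ : GaugeField (F.P K) 0 (Matrix.specialUnitaryGroup (Fin 2) ℂ), U₀ ∈ histGood F ℰp θ K J →
        (fun (F : T3Family) (J : ℕ) (V : GaugeField (F.P J) 0 (Matrix.specialUnitaryGroup (Fin 2) ℂ)) =>
        ∃ g : GaugeTransf (F.P J) 0 (Matrix.specialUnitaryGroup (Fin 2) ℂ),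
          (∀ e : PBond (F.P J) 0, Commute (((GaugeField.gaugeAct g V) e : Matrix.specialUnitaryGroup (Fin 2) ℂ) : Matrix (Fin 2) (Fin 2) ℂ) σ₃) ∧
          ∀ c : Site (F.P J) 0 → Matrix (Fin 2) (Fin 2) ℂ,
            (∀ e : PBond (F.P J) 0, c e.src = ((unitsField (toUField (GaugeField.gaugeAct g V)) e : (Matrix (Fin 2) (Fin 2) ℂ)ˣ) : Matrix (Fin 2) (Fin 2) ℂ) * c e.tgt *
            (((unitsField (toUField (GaugeField.gaugeAct g V)) e)⁻¹ : (Matrix (Fin 2) (Fin 2) ℂ)ˣ) : Matrix (Fin 2) (Fin 2) ℂ)) →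
            ∃ c₀ : Matrix (Fin 2) (Fin 2) ℂ, (∀ y, c y = c₀) ∧ Commute c₀ σ₃) F J (descendTo F ℰp J K hJK U₀) →
        (∀ t, t ≤ K - J → ∀ p : Plaq (F.P K) t,
          dist1 (GaugeField.plaqHol (Averaging.iter (fun k => BlockAveraging.blockAvg (P := F.P K) (j := k) ℰp) t U₀) p) ≤
            C_B * α * (F.L : ℝ) ^ (2 * t) * ((F.L : ℝ)⁻¹) ^ (2 * (K - J))) →
        ∀ ζ : PBond (F.P K) 0 → EuclideanSpace ℝ (Fin 3), (∀ ℓ, ‖ζ ℓ‖ ≤ Real.pi) →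
          (fun ℓ => expPoint (ζ ℓ) * U₀ ℓ : GaugeField (F.P K) 0 (Matrix.specialUnitaryGroup (Fin 2) ℂ)) ∈ histGood F ℰp θ K J →
            descendTo F ℰp J K hJK (fun ℓ => expPoint (ζ ℓ) * U₀ ℓ : GaugeField (F.P K) 0 (Matrix.specialUnitaryGroup (Fin 2) ℂ)) = descendTo F ℰp J K hJK U₀ →
            ∀ (wt : (j : ℕ) → PBond (F.P K) j → PBond (F.P K) (j + 1) → ℝ)
            (lift : (j : ℕ) → GaugeField (F.P K) (j + 1) SU2 → GaugeField (F.P K) j SU2)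
            (U₁ : GaugeField (F.P K) 0 SU2) (g g₀ : (j : ℕ) → Site (F.P K) j → SU2),
          (∀ j b e, wt j b e = if e.dir = b.dir ∧ (b.src b.dir - emb e.src b.dir).val < (F.P K).L then
              ∏ ν ∈ Finset.univ.erase b.dir, max 0 (1 - ((rel (emb e.src) b.src ν).natAbs : ℝ) / (F.P K).L) else 0) →
          (∀ j X b, lift j X b = expPoint (∑ e, wt j b e • ((((F.P K).L : ℕ) : ℝ)⁻¹ • logVec (su2Quat (X e))))) →
          (∀ j, j < K - J → ∀ x, g j x =
            (axialT (lift j (GaugeField.gaugeAct (g (j + 1)) (Averaging.iter (fun k => blockAvg (P := F.P K) (j := k) ℰp) (j + 1) (fun ℓ => expPoint (ζ ℓ) * U₀ ℓ))))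
                (emb (blockOf x)) x)⁻¹ *
              g (j + 1) (blockOf x) * axialT (Averaging.iter (fun k => blockAvg (P := F.P K) (j := k) ℰp) j (fun ℓ => expPoint (ζ ℓ) * U₀ ℓ)) (emb (blockOf x)) x) →
          (∀ j, K - J ≤ j → ∀ y, g j y = 1) →
          (∀ j, j < K - J → ∀ y : Site (F.P K) (j + 1), g j (emb y) = g (j + 1) y) →
          (∀ X : GaugeField (F.P K) 0 SU2, ∀ j, j ≤ K - J →
            Averaging.iter (fun k => blockAvg (P := F.P K) (j := k) ℰp) j (GaugeField.gaugeAct (g 0) X) =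
              GaugeField.gaugeAct (g j) (Averaging.iter (fun k => blockAvg (P := F.P K) (j := k) ℰp) j X)) →
          (∀ j, j < K - J → ∀ x,
            axialT (GaugeField.gaugeAct (g j) (Averaging.iter (fun k => blockAvg (P := F.P K) (j := k) ℰp) j (fun ℓ => expPoint (ζ ℓ) * U₀ ℓ))) (emb (blockOf x)) x =
              axialT (lift j (GaugeField.gaugeAct (g (j + 1)) (Averaging.iter (fun k => blockAvg (P := F.P K) (j := k) ℰp) (j + 1) (fun ℓ => expPoint (ζ ℓ) * U₀ ℓ))))
                (emb (blockOf x)) x) →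
          (∀ j, j < K - J →
            (blockAvg (P := F.P K) (j := j) ℰp).avg (GaugeField.gaugeAct (g j) (Averaging.iter (fun k => blockAvg (P := F.P K) (j := k) ℰp) j (fun ℓ => expPoint (ζ ℓ) * U₀ ℓ))) =
              GaugeField.gaugeAct (g (j + 1)) (Averaging.iter (fun k => blockAvg (P := F.P K) (j := k) ℰp) (j + 1) (fun ℓ => expPoint (ζ ℓ) * U₀ ℓ))) →
          (∀ j, j < K - J → ∀ x, g₀ j x =
            (axialT (lift j (GaugeField.gaugeAct (g₀ (j + 1)) (Averaging.iter (fun k => blockAvg (P := F.P K) (j := k) ℰp) (j + 1) U₁)))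
                (emb (blockOf x)) x)⁻¹ *
              g₀ (j + 1) (blockOf x) * axialT (Averaging.iter (fun k => blockAvg (P := F.P K) (j := k) ℰp) j U₁) (emb (blockOf x)) x) →
          (∀ j, K - J ≤ j → ∀ y, g₀ j y = 1) →
          (∀ j, j < K - J → ∀ y : Site (F.P K) (j + 1), g₀ j (emb y) = g₀ (j + 1) y) →
          (∀ X : GaugeField (F.P K) 0 SU2, ∀ j, j ≤ K - J →
            Averaging.iter (fun k => blockAvg (P := F.P K) (j := k) ℰp) j (GaugeField.gaugeAct (g₀ 0) X) =
              GaugeField.gaugeAct (g₀ j) (Averaging.iter (fun k => blockAvg (P := F.P K) (j := k) ℰp) j X)) →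
          (∀ j, j < K - J → ∀ x,
            axialT (GaugeField.gaugeAct (g₀ j) (Averaging.iter (fun k => blockAvg (P := F.P K) (j := k) ℰp) j U₁)) (emb (blockOf x)) x =
              axialT (lift j (GaugeField.gaugeAct (g₀ (j + 1)) (Averaging.iter (fun k => blockAvg (P := F.P K) (j := k) ℰp) (j + 1) U₁)))
                (emb (blockOf x)) x) →
          (∀ j, j < K - J →
            (blockAvg (P := F.P K) (j := j) ℰp).avg (GaugeField.gaugeAct (g₀ j) (Averaging.iter (fun k => blockAvg (P := F.P K) (j := k) ℰp) j U₁)) =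
              GaugeField.gaugeAct (g₀ (j + 1)) (Averaging.iter (fun k => blockAvg (P := F.P K) (j := k) ℰp) (j + 1) U₁)) →
          (∀ X : GaugeField (F.P K) 0 SU2, Averaging.iter (fun k => blockAvg (P := F.P K) (j := k) ℰp) (K - J) (GaugeField.gaugeAct (fun x => (g 0 x)⁻¹) X) = Averaging.iter (fun k => blockAvg (P := F.P K) (j := k) ℰp) (K - J) X) →
          (∀ X : GaugeField (F.P K) 0 SU2, Averaging.iter (fun k => blockAvg (P := F.P K) (j := k) ℰp) (K - J) (GaugeField.gaugeAct (g₀ 0) X) = Averaging.iter (fun k => blockAvg (P := F.P K) (j := k) ℰp) (K - J) X) →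
          U₀ = GaugeField.gaugeAct (fun x => (g 0 x)⁻¹ * g₀ 0 x) U₁ →

                      ∀ i, 1 ≤ i → i < K - J → ∀ e : PBond (F.P K) i,
            ‖logVec (su2Quat (GaugeField.gaugeAct (g i) (Averaging.iter (fun k => blockAvg (P := F.P K) (j := k) ℰp) i (fun ℓ => expPoint (ζ ℓ) * U₀ ℓ)) e))‖ ≤ 1 / 4 ∧
            ‖logVec (su2Quat (GaugeField.gaugeAct (g₀ i) (Averaging.iter (fun k => blockAvg (P := F.P K) (j := k) ℰp) i U₁) e))‖ ≤ 1 / 4) := by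
  intro h
  obtain ⟨α₀, hα₀, H⟩ := h 3 (by norm_num) 0 le_rfl
  -- the member `(L, m) = (3, 1)`
  let F : T3Family := ⟨3, ⟨by decide, by norm_num⟩, 1, le_rfl⟩
  have hFL : F.L = 3 := rfl
  -- the windows
  set α : ℝ := min α₀ (1 / 2000) with hαdef
  have hα0 : 0 < α := lt_min hα₀ (by norm_num); have hαα₀ : α ≤ α₀ := min_le_left _ _; have hα2 : α ≤ 1 / 2000 := min_le_right _ _
  have hGc : (((5 * F.L : ℕ) : ℝ) ^ 2 / 4) = 225 / 4 := by rw [hFL]; norm_num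
  set θ : ℕ → ℝ := fun _ => 2 * α / 225 with hθdef
  have hθpos : ∀ i, 0 < θ i := fun i => by rw [hθdef]; positivity
  have hθ0 : ∀ i, 0 ≤ θ i := fun i => (hθpos i).le
  have hwin : ∀ i, 0 < i → i ≤ 2 → (((5 * F.L : ℕ) : ℝ) ^ 2 / 4) * θ i ≤ α := by
    intro i _ _; rw [hGc, hθdef]; linarith
  have hsum : (∑ i ∈ Finset.range (2 - 0), (((5 * F.L : ℕ) : ℝ) ^ 2 / 4) * θ (2 - i)) ≤ α := by
    rw [hGc]; simp only [hθdef, Finset.sum_range_succ, Finset.sum_range_zero]; linarith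
  have h24 : α ≤ 1 / 24 := by linarith
  have hδ : α < deltaSU (Fin 2) := by
    unfold ExpMeanLog.deltaSU
    rw [Fintype.card_fin]
    refine lt_min (by linarith) ?_
    have := Real.pi_gt_three
    rw [lt_div_iff₀ (by norm_num : (0 : ℝ) < (2 : ℕ))]
    push_cast; linarith
  have h157 : 157 * α < ((F.L : ℝ) ^ 2)⁻¹ := by rw [hFL]; norm_num; linarith
  -- the toron data
  set D : SU2 := expPoint ((1 / 9 : ℝ) • (EuclideanSpace.single (0 : Fin 3) (1 : ℝ))) with hD
  let μ₀ : Fin (F.P 2).d := ⟨0, (F.P 2).hd⟩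
  set U₀ : GaugeField (F.P 2) 0 SU2 := fun b => if b.dir = μ₀ then D else 1 with hU₀def
  have hU₀ : ∀ b, U₀ b = if b.dir = μ₀ then D else 1 := fun _ => rfl
  have hiter := iter_constDir F 2 D μ₀ hU₀
  have hDpow : ∀ n : ℕ, D ^ n = expPoint ((((n : ℕ) : ℝ) * (1 / 9)) • (EuclideanSpace.single (0 : Fin 3) (1 : ℝ))) := fun n => by rw [hD, expPoint_smul_pow]
  -- every averaged level is flat: the small-field history and the (BKG) clause
  have hplaq : ∀ (t : ℕ) (p : Plaq (F.P 2) t),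
      GaugeField.plaqHol (Averaging.iter (fun k => blockAvg (P := F.P 2) (j := k) ℰp) t U₀) p = 1 :=
    fun t p => plaqHol_constDir (D ^ (F.L ^ t)) μ₀ (hiter t) p
  have hgood : U₀ ∈ histGood F ℰp θ 2 0 := by
    intro j _ p; rw [hplaq, GaugeGroup.dist1_one]; exact hθpos 0
  have hBKG : ∀ t, t ≤ 2 - 0 → ∀ p : Plaq (F.P 2) t,
      dist1 (GaugeField.plaqHol (Averaging.iter (fun k => BlockAveraging.blockAvg (P := F.P 2) (j := k) ℰp) t U₀) p) ≤
        0 * α * (F.L : ℝ) ^ (2 * t) * ((F.L : ℝ)⁻¹) ^ (2 * (2 - 0)) := by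
    intro t _ p; rw [hplaq, GaugeGroup.dist1_one]; simp
  -- the datum is the coarse toron `expPoint (1·e₀)` on the `6³` torus, which lies on the abelian stratum
  have hdesc : descendTo F ℰp 0 2 (by omega) U₀ =
      (fun b : PBond (F.P 0) 0 => if b.dir = ⟨0, (F.P 0).hd⟩ then expPoint ((1 : ℝ) • EuclideanSpace.single (0 : Fin 3) (1 : ℝ)) else 1) := by
    funext ℓ
    rw [descendTo_apply_eq_iter_of_eq F (n := 0) (K := 2) (by omega) (a := 2) rfl U₀ ℓ, hiter 2, bondShift_dir, hDpow, hFL]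
    rw [show (((3 ^ 2 : ℕ) : ℕ) : ℝ) * (1 / 9) = 1 by norm_num]
    rfl
  have hsix : (((F.P 0).sitesPerDir 0 : ℕ) : ℝ) = 6 := by
    rw [FluctuationComparisonRegPrIntLS2BetaSmallBondGaugeToronObstruction.sitesPerDir_run_zero F, hFL]
    norm_num
  have hGA := FluctuationComparisonRegPrIntLS2BetaSmallBondGaugeToronAbelianStratum.toron_mem_abelianStratum F 0 (a := (1 : ℝ))
    (by rw [hsix, mul_one]; exact sin_six_ne_zero)
  -- the partner `W := expPoint 0 • U₀ = U₀` and the AxStage witness `(wt, lift, U₀, 1, 1)`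
  set ζ : PBond (F.P 2) 0 → EuclideanSpace ℝ (Fin 3) := fun _ => 0 with hζdef
  have hζ : ∀ ℓ, ‖ζ ℓ‖ ≤ Real.pi := fun ℓ => by rw [hζdef]; simp [Real.pi_pos.le]
  have hWU : (fun ℓ => expPoint (ζ ℓ) * U₀ ℓ : GaugeField (F.P 2) 0 (Matrix.specialUnitaryGroup (Fin 2) ℂ)) = U₀ := by
    funext ℓ; rw [hζdef]; dsimp only; rw [expPoint_zero, one_mul]
  set wt : (j : ℕ) → PBond (F.P 2) j → PBond (F.P 2) (j + 1) → ℝ := fun j b e =>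
    if e.dir = b.dir ∧ (b.src b.dir - emb e.src b.dir).val < (F.P 2).L then
      ∏ ν ∈ Finset.univ.erase b.dir, max 0 (1 - ((rel (emb e.src) b.src ν).natAbs : ℝ) / (F.P 2).L) else 0 with hwtdef
  have hwt : ∀ j b e, wt j b e = if e.dir = b.dir ∧ (b.src b.dir - emb e.src b.dir).val < (F.P 2).L then
      ∏ ν ∈ Finset.univ.erase b.dir, max 0 (1 - ((rel (emb e.src) b.src ν).natAbs : ℝ) / (F.P 2).L) else 0 := fun _ _ _ => rfl
  set lift : (j : ℕ) → GaugeField (F.P 2) (j + 1) SU2 → GaugeField (F.P 2) j SU2 := fun j X b =>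
    expPoint (∑ e, wt j b e • ((((F.P 2).L : ℕ) : ℝ)⁻¹ • logVec (su2Quat (X e)))) with hliftdef
  have hlift : ∀ j X b, lift j X b = expPoint (∑ e, wt j b e • ((((F.P 2).L : ℕ) : ℝ)⁻¹ • logVec (su2Quat (X e)))) := fun _ _ _ => rfl
  -- the hat lift of each toron level is the level below
  have hliftEq : ∀ j, j < 2 →
      lift j (Averaging.iter (fun k => blockAvg (P := F.P 2) (j := k) ℰp) (j + 1) U₀) =
        Averaging.iter (fun k => blockAvg (P := F.P 2) (j := k) ℰp) j U₀ := by
    intro j hj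
    funext b
    have hj3 : j + 1 ≤ (F.P 2).m + (F.P 2).K := by show j + 1 ≤ 1 + 2; omega
    rw [hlift, show (((F.P 2).L : ℕ) : ℝ) = ((F.P 2).L : ℝ) from rfl,
      hatLift_constDir hj3 (wt j) (hwt j) (D ^ (F.L ^ (j + 1))) μ₀ (hiter (j + 1)) b, hiter j b]
    by_cases hb : b.dir = μ₀
    · rw [if_pos hb, if_pos hb, hDpow, hDpow, show ((F.P 2).L : ℝ) = 3 from by rw [show (F.P 2).L = F.L from rfl, hFL]; norm_num, hFL]
      have hlt : |(((3 ^ (j + 1) : ℕ) : ℕ) : ℝ) * (1 / 9)| < Real.pi := by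
        interval_cases j <;> norm_num [abs_of_pos] <;> linarith [Real.pi_gt_three]
      rw [expPoint_root_e0 _ _ hlt]; congr 1; interval_cases j <;> norm_num
    · rw [if_neg hb, if_neg hb]
  -- the letter applied to the witness
  have key := H F hFL 0 2 (by omega) θ hθ0 α hwin hsum h24 hδ h157 hαα₀ U₀ hgood (by rw [hdesc]; exact hGA) hBKG ζ hζ
    (by rw [hWU]; exact hgood) (by rw [hWU]) wt lift U₀ (fun _ _ => 1) (fun _ _ => 1) hwt hlift
    (by -- (g-def)
      intro j hj x
      rw [hWU, B12RTGaugeInvariance254.gaugeAct_one', hliftEq j (by omega), mul_one, inv_mul_cancel])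
    (fun _ _ _ => rfl) (fun _ _ _ => rfl)
    (by intro X j _; rw [B12RTGaugeInvariance254.gaugeAct_one', B12RTGaugeInvariance254.gaugeAct_one'])
    (by intro j hj x; rw [hWU, B12RTGaugeInvariance254.gaugeAct_one', B12RTGaugeInvariance254.gaugeAct_one', hliftEq j (by omega)])
    (by intro j hj; rw [hWU, B12RTGaugeInvariance254.gaugeAct_one', B12RTGaugeInvariance254.gaugeAct_one']; rfl)
    (by intro j hj x; rw [B12RTGaugeInvariance254.gaugeAct_one', hliftEq j (by omega), mul_one, inv_mul_cancel])
    (fun _ _ _ => rfl) (fun _ _ _ => rfl)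
    (by intro X j _; rw [B12RTGaugeInvariance254.gaugeAct_one', B12RTGaugeInvariance254.gaugeAct_one'])
    (by intro j hj x; rw [B12RTGaugeInvariance254.gaugeAct_one', B12RTGaugeInvariance254.gaugeAct_one', hliftEq j (by omega)])
    (by intro j hj; rw [B12RTGaugeInvariance254.gaugeAct_one', B12RTGaugeInvariance254.gaugeAct_one']; rfl)
    (by intro X; simp only [inv_one]; rw [B12RTGaugeInvariance254.gaugeAct_one'])
    (by intro X; rw [B12RTGaugeInvariance254.gaugeAct_one'])
    (by simp only [inv_one, mul_one]; rw [B12RTGaugeInvariance254.gaugeAct_one'])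
    1 le_rfl (by norm_num) ⟨fun _ => 0, ⟨0, (F.P 2).hd⟩⟩
  -- the tower bond at internal height `1` is the toron `expPoint ((1∕3)·e₀)`, of arc `1∕3`
  have hval : GaugeField.gaugeAct ((fun (_ : ℕ) (_ : Site (F.P 2) 1) => (1 : SU2)) 1)
      (Averaging.iter (fun k => blockAvg (P := F.P 2) (j := k) ℰp) 1 (fun ℓ => expPoint (ζ ℓ) * U₀ ℓ)) ⟨fun _ => 0, ⟨0, (F.P 2).hd⟩⟩ =
        expPoint ((1 / 3 : ℝ) • (EuclideanSpace.single (0 : Fin 3) (1 : ℝ))) := by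
    rw [hWU, B12RTGaugeInvariance254.gaugeAct_one', hiter 1, if_pos rfl, hDpow, hFL]
    norm_num
  have harc := key.1
  rw [hval, arc_expPoint_e0 _ (by rw [abs_of_pos (by norm_num : (0:ℝ) < 1/3)]; linarith [Real.pi_gt_three])] at harc
  norm_num [abs_of_pos] at harc

/-- ★★★ **COROLLARY — THE KNIT's `hARC` SOCKET, READ AS ONE GUARD-UNIFORM LETTER, IS UNINHABITED.**  The hypothesis `hARC : ∀ G, …` of
✓`supTowerLetter4_of_arc_discSplit` quantifies over every guard `G`; at `G := G_A′` it is false, so NO single term inhabits it — the arc-profile letter must be supplied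
GUARD BY GUARD (✓`…S2BetaArcLetterOfGuard` for guards carrying the small-bond conjunct), and for the abelian stratum of knits v4–v7 the sup-chain road needs a reshaped
start (a volume∕co-height floor or a late-start letter), not a supplier. [cite: Balaban1985RegularSpaces, (1.29) p.81] -/
theorem not_forall_guard_arcLetter4 :
    ¬ (∀ (G : (F : T3Family) → (J : ℕ) → GaugeField (F.P J) 0 (Matrix.specialUnitaryGroup (Fin 2) ℂ) → Prop),
      ∀ (L : ℕ), 1 < L → ∀ (C_B : ℝ), 0 ≤ C_B → ∃ α₀ : ℝ, 0 < α₀ ∧ ∀ (F : T3Family), F.L = L →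
      ∀ (J K : ℕ) (hJK : J ≤ K) (θ : ℕ → ℝ), (∀ i, 0 ≤ θ i) → ∀ (α : ℝ), (∀ i, J < i → i ≤ K → (((5 * F.L : ℕ) : ℝ) ^ 2 / 4) * θ i ≤ α) →
        (∑ i ∈ Finset.range (K - J), (((5 * F.L : ℕ) : ℝ) ^ 2 / 4) * θ (K - i)) ≤ α →
        α ≤ 1 / 24 → α < deltaSU (Fin 2) → 157 * α < ((F.L : ℝ) ^ 2)⁻¹ → α ≤ α₀ →
        ∀ U₀ : GaugeField (F.P K) 0 (Matrix.specialUnitaryGroup (Fin 2) ℂ), U₀ ∈ histGood F ℰp θ K J →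
        G F J (descendTo F ℰp J K hJK U₀) →
        (∀ t, t ≤ K - J → ∀ p : Plaq (F.P K) t,
          dist1 (GaugeField.plaqHol (Averaging.iter (fun k => BlockAveraging.blockAvg (P := F.P K) (j := k) ℰp) t U₀) p) ≤
            C_B * α * (F.L : ℝ) ^ (2 * t) * ((F.L : ℝ)⁻¹) ^ (2 * (K - J))) →
        ∀ ζ : PBond (F.P K) 0 → EuclideanSpace ℝ (Fin 3), (∀ ℓ, ‖ζ ℓ‖ ≤ Real.pi) →
          (fun ℓ => expPoint (ζ ℓ) * U₀ ℓ : GaugeField (F.P K) 0 (Matrix.specialUnitaryGroup (Fin 2) ℂ)) ∈ histGood F ℰp θ K J →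
            descendTo F ℰp J K hJK (fun ℓ => expPoint (ζ ℓ) * U₀ ℓ : GaugeField (F.P K) 0 (Matrix.specialUnitaryGroup (Fin 2) ℂ)) = descendTo F ℰp J K hJK U₀ →
            ∀ (wt : (j : ℕ) → PBond (F.P K) j → PBond (F.P K) (j + 1) → ℝ)
            (lift : (j : ℕ) → GaugeField (F.P K) (j + 1) SU2 → GaugeField (F.P K) j SU2)
            (U₁ : GaugeField (F.P K) 0 SU2) (g g₀ : (j : ℕ) → Site (F.P K) j → SU2),
          (∀ j b e, wt j b e = if e.dir = b.dir ∧ (b.src b.dir - emb e.src b.dir).val < (F.P K).L then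
              ∏ ν ∈ Finset.univ.erase b.dir, max 0 (1 - ((rel (emb e.src) b.src ν).natAbs : ℝ) / (F.P K).L) else 0) →
          (∀ j X b, lift j X b = expPoint (∑ e, wt j b e • ((((F.P K).L : ℕ) : ℝ)⁻¹ • logVec (su2Quat (X e))))) →
          (∀ j, j < K - J → ∀ x, g j x =
            (axialT (lift j (GaugeField.gaugeAct (g (j + 1)) (Averaging.iter (fun k => blockAvg (P := F.P K) (j := k) ℰp) (j + 1) (fun ℓ => expPoint (ζ ℓ) * U₀ ℓ))))
                (emb (blockOf x)) x)⁻¹ *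
              g (j + 1) (blockOf x) * axialT (Averaging.iter (fun k => blockAvg (P := F.P K) (j := k) ℰp) j (fun ℓ => expPoint (ζ ℓ) * U₀ ℓ)) (emb (blockOf x)) x) →
          (∀ j, K - J ≤ j → ∀ y, g j y = 1) →
          (∀ j, j < K - J → ∀ y : Site (F.P K) (j + 1), g j (emb y) = g (j + 1) y) →
          (∀ X : GaugeField (F.P K) 0 SU2, ∀ j, j ≤ K - J →
            Averaging.iter (fun k => blockAvg (P := F.P K) (j := k) ℰp) j (GaugeField.gaugeAct (g 0) X) =
              GaugeField.gaugeAct (g j) (Averaging.iter (fun k => blockAvg (P := F.P K) (j := k) ℰp) j X)) →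
          (∀ j, j < K - J → ∀ x,
            axialT (GaugeField.gaugeAct (g j) (Averaging.iter (fun k => blockAvg (P := F.P K) (j := k) ℰp) j (fun ℓ => expPoint (ζ ℓ) * U₀ ℓ))) (emb (blockOf x)) x =
              axialT (lift j (GaugeField.gaugeAct (g (j + 1)) (Averaging.iter (fun k => blockAvg (P := F.P K) (j := k) ℰp) (j + 1) (fun ℓ => expPoint (ζ ℓ) * U₀ ℓ))))
                (emb (blockOf x)) x) →
          (∀ j, j < K - J →
            (blockAvg (P := F.P K) (j := j) ℰp).avg (GaugeField.gaugeAct (g j) (Averaging.iter (fun k => blockAvg (P := F.P K) (j := k) ℰp) j (fun ℓ => expPoint (ζ ℓ) * U₀ ℓ))) =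
              GaugeField.gaugeAct (g (j + 1)) (Averaging.iter (fun k => blockAvg (P := F.P K) (j := k) ℰp) (j + 1) (fun ℓ => expPoint (ζ ℓ) * U₀ ℓ))) →
          (∀ j, j < K - J → ∀ x, g₀ j x =
            (axialT (lift j (GaugeField.gaugeAct (g₀ (j + 1)) (Averaging.iter (fun k => blockAvg (P := F.P K) (j := k) ℰp) (j + 1) U₁)))
                (emb (blockOf x)) x)⁻¹ *
              g₀ (j + 1) (blockOf x) * axialT (Averaging.iter (fun k => blockAvg (P := F.P K) (j := k) ℰp) j U₁) (emb (blockOf x)) x) →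
          (∀ j, K - J ≤ j → ∀ y, g₀ j y = 1) →
          (∀ j, j < K - J → ∀ y : Site (F.P K) (j + 1), g₀ j (emb y) = g₀ (j + 1) y) →
          (∀ X : GaugeField (F.P K) 0 SU2, ∀ j, j ≤ K - J →
            Averaging.iter (fun k => blockAvg (P := F.P K) (j := k) ℰp) j (GaugeField.gaugeAct (g₀ 0) X) =
              GaugeField.gaugeAct (g₀ j) (Averaging.iter (fun k => blockAvg (P := F.P K) (j := k) ℰp) j X)) →
          (∀ j, j < K - J → ∀ x,
            axialT (GaugeField.gaugeAct (g₀ j) (Averaging.iter (fun k => blockAvg (P := F.P K) (j := k) ℰp) j U₁)) (emb (blockOf x)) x =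
              axialT (lift j (GaugeField.gaugeAct (g₀ (j + 1)) (Averaging.iter (fun k => blockAvg (P := F.P K) (j := k) ℰp) (j + 1) U₁)))
                (emb (blockOf x)) x) →
          (∀ j, j < K - J →
            (blockAvg (P := F.P K) (j := j) ℰp).avg (GaugeField.gaugeAct (g₀ j) (Averaging.iter (fun k => blockAvg (P := F.P K) (j := k) ℰp) j U₁)) =
              GaugeField.gaugeAct (g₀ (j + 1)) (Averaging.iter (fun k => blockAvg (P := F.P K) (j := k) ℰp) (j + 1) U₁)) →
          (∀ X : GaugeField (F.P K) 0 SU2, Averaging.iter (fun k => blockAvg (P := F.P K) (j := k) ℰp) (K - J) (GaugeField.gaugeAct (fun x => (g 0 x)⁻¹) X) = Averaging.iter (fun k => blockAvg (P := F.P K) (j := k) ℰp) (K - J) X) →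
          (∀ X : GaugeField (F.P K) 0 SU2, Averaging.iter (fun k => blockAvg (P := F.P K) (j := k) ℰp) (K - J) (GaugeField.gaugeAct (g₀ 0) X) = Averaging.iter (fun k => blockAvg (P := F.P K) (j := k) ℰp) (K - J) X) →
          U₀ = GaugeField.gaugeAct (fun x => (g 0 x)⁻¹ * g₀ 0 x) U₁ →

                      ∀ i, 1 ≤ i → i < K - J → ∀ e : PBond (F.P K) i,
            ‖logVec (su2Quat (GaugeField.gaugeAct (g i) (Averaging.iter (fun k => blockAvg (P := F.P K) (j := k) ℰp) i (fun ℓ => expPoint (ζ ℓ) * U₀ ℓ)) e))‖ ≤ 1 / 4 ∧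
            ‖logVec (su2Quat (GaugeField.gaugeAct (g₀ i) (Averaging.iter (fun k => blockAvg (P := F.P K) (j := k) ℰp) i U₁) e))‖ ≤ 1 / 4) :=
  fun h => arcLetter4_abelianStratum_false (h
    (fun (F : T3Family) (J : ℕ) (V : GaugeField (F.P J) 0 (Matrix.specialUnitaryGroup (Fin 2) ℂ)) =>
        ∃ g : GaugeTransf (F.P J) 0 (Matrix.specialUnitaryGroup (Fin 2) ℂ),
          (∀ e : PBond (F.P J) 0, Commute (((GaugeField.gaugeAct g V) e : Matrix.specialUnitaryGroup (Fin 2) ℂ) : Matrix (Fin 2) (Fin 2) ℂ) σ₃) ∧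
          ∀ c : Site (F.P J) 0 → Matrix (Fin 2) (Fin 2) ℂ,
            (∀ e : PBond (F.P J) 0, c e.src = ((unitsField (toUField (GaugeField.gaugeAct g V)) e : (Matrix (Fin 2) (Fin 2) ℂ)ˣ) : Matrix (Fin 2) (Fin 2) ℂ) * c e.tgt *
            (((unitsField (toUField (GaugeField.gaugeAct g V)) e)⁻¹ : (Matrix (Fin 2) (Fin 2) ℂ)ˣ) : Matrix (Fin 2) (Fin 2) ℂ)) →
            ∃ c₀ : Matrix (Fin 2) (Fin 2) ℂ, (∀ y, c y = c₀) ∧ Commute c₀ σ₃))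

end Summit.QuantumFields.YangMills.Theorems.FluctuationComparisonRegPrIntLS2BetaArcLetterAbelianStratumFalse

end
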